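import Summits.BirchSwinnertonDyer.BirchSwinnertonDyer.Theorems.KolyvaginDepthDoorDepthTableLambdaRowPrediction
import HarnessLib

/-!
# Route `KolyvaginDepthDoor` — Hypothesis ♠ (W. Zhang 2014) at the row's prime for the remaining 14
# semistable depth-table curves, kernel-decided (crux `KolyvaginDepthSupply`, stmt-BirchSwinnertonDyer-21765)

Helper file (`--supports stmt-BirchSwinnertonDyer-21765 --as helper`); it closes nothing and BSD is
not proved by it. Sequel of `KolyvaginDepthDoorDepthTableLambdaRowPrediction` (module docstring
there; erratum to its count: `p` is INERT in the row's field for 14 of the 18 rows — `d_K ∈ {−7, −8,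
−23, −83, −52, −67}` at `p = 5`, `−51` at `p = 7` — and split for 4, `d_K ∈ {−39, −19, −111, −31}`): the two side conditions of W. Zhang 2014 Thm. 1.1 (`N⁻ = 1` form,
`WZhang2014_exists_kolyvaginClass_one_ne_zero`) that are NOT already in g2's row files — ♠(1) «every
multiplicative `ℓ` has `p ∤ v_ℓ(Δ_min)`» and semistability over `ℤ` (making ♠(2) vacuous) — decided
in the kernel on the integer model (`not_dvd_padicValInt_of_intModel`: prime-power exponents of
`Δ(E₀)`, all in `{1, 2, 4}`; `isSemistable_int_of_intModel_of_isCoprime`: `gcd(c₄, Δ) = 1`) for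
`433a1, 446d1, 563a1, 571b1, 643a1, 655a1 (p = 7), 681c1, 707a1, 709a1, 718b1, 794a1, 817a1, 997b1,
997c1`. With g2's `C<label>.hasSurjectiveModNGaloisRep_p`, `heegner_negD`, the KernelCerts rank
certificate and the atlas cell, each composes with `exists_kolyvaginPrime_class_ne_zero_at_of_atlasCell`
exactly as `C389a1.exists_kolyvaginPrime_class_ne_zero_of_lambda_at` does: the cyclotomic certificate
+ `s_p(E^{(d_K)}) ≤ 1` predict a non-zero class at SOME Kolyvagin prime of the row's OWN field `K`.
The three curves additive at `2` (`664a1`, `916c1`, `944e1`) have one multiplicative prime and are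
outside ♠(2) — but their depth-table fields have `d_K` odd with `5` SPLIT (`−39, −111, −31`; also
`707a1`, `−19`), so the tree's BCGS 2026 fact applies at the row's own field:
`exists_kolyvaginPrime_class_ne_zero_at_of_atlasCell_split` (last §). Hence EVERY one of the 18 rows
has a row-specific λ-prediction modulo print + symbol data + the twist datum `s_p(E^{(d_K)}) ≤ 1`. Per-curve; BSD is not proved by any of this.

References: [WZhang2014] Thm. 1.1 (p. 195), Hypothesis ♠ (pp. 194–195); [CremonaAlgorithms1997]
Table 1; [SilvermanAEC2009] VII.5 Prop. 5.1.
-/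

set_option linter.dupNamespace false

noncomputable section

open scoped Classical NumberField

namespace Summit.BirchSwinnertonDyer.BirchSwinnertonDyer.Theorems.KolyvaginDepthDoor

open Literature.NumberTheory.EllipticCurves Literature.NumberTheory.EllipticCurves.ModularForms
  WeierstrassCurve
open Summit.BirchSwinnertonDyer.BirchSwinnertonDyer.Rank2Observatory
open Summit.BirchSwinnertonDyer.BirchSwinnertonDyer.Rank1Residual CongruenceSubgroup

/-! ## Hypothesis ♠ at the row's prime, 14 semistable depth-table curves -/

namespace C433a1

/-- **♠ for `433a1` at `p = 5`:** `|Δ_min| = 433` (exponent `1`) ⇒ `5 ∤ v_ℓ(Δ_min)` at every multiplicative `ℓ`;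
`gcd(c₄, Δ) = 1` ⇒ semistable. [cite: WZhang2014, Hypothesis ♠ (pp. 194–195)] [cite: CremonaAlgorithms1997, Table 1 (433a1)] -/
theorem spade_5 :
    haveI := isElliptic_c433a1;
    haveI := isGloballyMinimal_c433a1;
    (∀ (ℓ : ℕ) [Fact ℓ.Prime], ((⟨1, 0, 0, 0, 1⟩ : WeierstrassCurve ℤ).map (Int.castRingHom ℚ)).HasMultiplicativeReductionAtPrime ℓ →
      ¬ 5 ∣ padicValInt ℓ ((⟨1, 0, 0, 0, 1⟩ : WeierstrassCurve ℤ).map (Int.castRingHom ℚ)).minimalDiscriminantInt) ∧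
      ((⟨1, 0, 0, 0, 1⟩ : WeierstrassCurve ℤ).map (Int.castRingHom ℚ)).IsSemistable ℤ := by
  haveI := isElliptic_c433a1
  haveI := isGloballyMinimal_c433a1
  haveI := Fact.mk (by norm_num : Nat.Prime 5)
  exact ⟨not_dvd_padicValInt_of_intModel intModel 5
      (forall_prime_dvd_of_natAbs_eq_pow (a := 433) (i := 1) (by decide +kernel) (by norm_num)
        ⟨1, by decide +kernel, by decide +kernel, by norm_num⟩),
    isSemistable_int_of_intModel_of_isCoprime intModel
      (by rw [Int.isCoprime_iff_gcd_eq_one]; decide +kernel)⟩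

end C433a1

namespace C446d1

/-- **♠ for `446d1` at `p = 5`:** `|Δ_min| = 2^2·223` ⇒ `5 ∤ v_ℓ(Δ_min)` at every multiplicative `ℓ`;
`gcd(c₄, Δ) = 1` ⇒ semistable. [cite: WZhang2014, Hypothesis ♠ (pp. 194–195)] [cite: CremonaAlgorithms1997, Table 1 (446d1)] -/
theorem spade_5 :
    haveI := isElliptic_c446d1;
    haveI := isGloballyMinimal_c446d1;
    (∀ (ℓ : ℕ) [Fact ℓ.Prime], ((⟨1, -1, 0, -4, 4⟩ : WeierstrassCurve ℤ).map (Int.castRingHom ℚ)).HasMultiplicativeReductionAtPrime ℓ →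
      ¬ 5 ∣ padicValInt ℓ ((⟨1, -1, 0, -4, 4⟩ : WeierstrassCurve ℤ).map (Int.castRingHom ℚ)).minimalDiscriminantInt) ∧
      ((⟨1, -1, 0, -4, 4⟩ : WeierstrassCurve ℤ).map (Int.castRingHom ℚ)).IsSemistable ℤ := by
  haveI := isElliptic_c446d1
  haveI := isGloballyMinimal_c446d1
  haveI := Fact.mk (by norm_num : Nat.Prime 5)
  exact ⟨not_dvd_padicValInt_of_intModel intModel 5
      (forall_prime_dvd_of_natAbs_eq_pow_mul_pow (a := 2) (i := 2) (b := 223) (j := 1) (by decide +kernel)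
        (by norm_num) (by norm_num) ⟨2, by decide +kernel, by decide +kernel, by norm_num⟩
        ⟨1, by decide +kernel, by decide +kernel, by norm_num⟩),
    isSemistable_int_of_intModel_of_isCoprime intModel
      (by rw [Int.isCoprime_iff_gcd_eq_one]; decide +kernel)⟩

end C446d1

namespace C563a1

/-- **♠ for `563a1` at `p = 5`:** `|Δ_min| = 563` (exponent `1`) ⇒ `5 ∤ v_ℓ(Δ_min)` at every multiplicative `ℓ`;
`gcd(c₄, Δ) = 1` ⇒ semistable. [cite: WZhang2014, Hypothesis ♠ (pp. 194–195)] [cite: CremonaAlgorithms1997, Table 1 (563a1)] -/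
theorem spade_5 :
    haveI := isElliptic_c563a1;
    haveI := isGloballyMinimal_c563a1;
    (∀ (ℓ : ℕ) [Fact ℓ.Prime], ((⟨1, 1, 1, -15, 16⟩ : WeierstrassCurve ℤ).map (Int.castRingHom ℚ)).HasMultiplicativeReductionAtPrime ℓ →
      ¬ 5 ∣ padicValInt ℓ ((⟨1, 1, 1, -15, 16⟩ : WeierstrassCurve ℤ).map (Int.castRingHom ℚ)).minimalDiscriminantInt) ∧
      ((⟨1, 1, 1, -15, 16⟩ : WeierstrassCurve ℤ).map (Int.castRingHom ℚ)).IsSemistable ℤ := by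
  haveI := isElliptic_c563a1
  haveI := isGloballyMinimal_c563a1
  haveI := Fact.mk (by norm_num : Nat.Prime 5)
  exact ⟨not_dvd_padicValInt_of_intModel intModel 5
      (forall_prime_dvd_of_natAbs_eq_pow (a := 563) (i := 1) (by decide +kernel) (by norm_num)
        ⟨1, by decide +kernel, by decide +kernel, by norm_num⟩),
    isSemistable_int_of_intModel_of_isCoprime intModel
      (by rw [Int.isCoprime_iff_gcd_eq_one]; decide +kernel)⟩

end C563a1

namespace C571b1

/-- **♠ for `571b1` at `p = 5`:** `|Δ_min| = 571` (exponent `1`) ⇒ `5 ∤ v_ℓ(Δ_min)` at every multiplicative `ℓ`;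
`gcd(c₄, Δ) = 1` ⇒ semistable. [cite: WZhang2014, Hypothesis ♠ (pp. 194–195)] [cite: CremonaAlgorithms1997, Table 1 (571b1)] -/
theorem spade_5 :
    haveI := isElliptic_c571b1;
    haveI := isGloballyMinimal_c571b1;
    (∀ (ℓ : ℕ) [Fact ℓ.Prime], ((⟨0, 1, 1, -4, 2⟩ : WeierstrassCurve ℤ).map (Int.castRingHom ℚ)).HasMultiplicativeReductionAtPrime ℓ →
      ¬ 5 ∣ padicValInt ℓ ((⟨0, 1, 1, -4, 2⟩ : WeierstrassCurve ℤ).map (Int.castRingHom ℚ)).minimalDiscriminantInt) ∧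
      ((⟨0, 1, 1, -4, 2⟩ : WeierstrassCurve ℤ).map (Int.castRingHom ℚ)).IsSemistable ℤ := by
  haveI := isElliptic_c571b1
  haveI := isGloballyMinimal_c571b1
  haveI := Fact.mk (by norm_num : Nat.Prime 5)
  exact ⟨not_dvd_padicValInt_of_intModel intModel 5
      (forall_prime_dvd_of_natAbs_eq_pow (a := 571) (i := 1) (by decide +kernel) (by norm_num)
        ⟨1, by decide +kernel, by decide +kernel, by norm_num⟩),
    isSemistable_int_of_intModel_of_isCoprime intModel
      (by rw [Int.isCoprime_iff_gcd_eq_one]; decide +kernel)⟩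

end C571b1

namespace C643a1

/-- **♠ for `643a1` at `p = 5`:** `|Δ_min| = 643` (exponent `1`) ⇒ `5 ∤ v_ℓ(Δ_min)` at every multiplicative `ℓ`;
`gcd(c₄, Δ) = 1` ⇒ semistable. [cite: WZhang2014, Hypothesis ♠ (pp. 194–195)] [cite: CremonaAlgorithms1997, Table 1 (643a1)] -/
theorem spade_5 :
    haveI := isElliptic_c643a1;
    haveI := isGloballyMinimal_c643a1;
    (∀ (ℓ : ℕ) [Fact ℓ.Prime], ((⟨1, 0, 0, -4, 3⟩ : WeierstrassCurve ℤ).map (Int.castRingHom ℚ)).HasMultiplicativeReductionAtPrime ℓ →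
      ¬ 5 ∣ padicValInt ℓ ((⟨1, 0, 0, -4, 3⟩ : WeierstrassCurve ℤ).map (Int.castRingHom ℚ)).minimalDiscriminantInt) ∧
      ((⟨1, 0, 0, -4, 3⟩ : WeierstrassCurve ℤ).map (Int.castRingHom ℚ)).IsSemistable ℤ := by
  haveI := isElliptic_c643a1
  haveI := isGloballyMinimal_c643a1
  haveI := Fact.mk (by norm_num : Nat.Prime 5)
  exact ⟨not_dvd_padicValInt_of_intModel intModel 5
      (forall_prime_dvd_of_natAbs_eq_pow (a := 643) (i := 1) (by decide +kernel) (by norm_num)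
        ⟨1, by decide +kernel, by decide +kernel, by norm_num⟩),
    isSemistable_int_of_intModel_of_isCoprime intModel
      (by rw [Int.isCoprime_iff_gcd_eq_one]; decide +kernel)⟩

end C643a1

namespace C655a1

/-- **♠ for `655a1` at `p = 7`:** `|Δ_min| = 5^2·131` ⇒ `7 ∤ v_ℓ(Δ_min)` at every multiplicative `ℓ`;
`gcd(c₄, Δ) = 1` ⇒ semistable. [cite: WZhang2014, Hypothesis ♠ (pp. 194–195)] [cite: CremonaAlgorithms1997, Table 1 (655a1)] -/
theorem spade_7 :
    haveI := isElliptic_c655a1;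
    haveI := isGloballyMinimal_c655a1;
    (∀ (ℓ : ℕ) [Fact ℓ.Prime], ((⟨0, 0, 1, -13, 18⟩ : WeierstrassCurve ℤ).map (Int.castRingHom ℚ)).HasMultiplicativeReductionAtPrime ℓ →
      ¬ 7 ∣ padicValInt ℓ ((⟨0, 0, 1, -13, 18⟩ : WeierstrassCurve ℤ).map (Int.castRingHom ℚ)).minimalDiscriminantInt) ∧
      ((⟨0, 0, 1, -13, 18⟩ : WeierstrassCurve ℤ).map (Int.castRingHom ℚ)).IsSemistable ℤ := by
  haveI := isElliptic_c655a1
  haveI := isGloballyMinimal_c655a1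
  haveI := Fact.mk (by norm_num : Nat.Prime 7)
  exact ⟨not_dvd_padicValInt_of_intModel intModel 7
      (forall_prime_dvd_of_natAbs_eq_pow_mul_pow (a := 5) (i := 2) (b := 131) (j := 1) (by decide +kernel)
        (by norm_num) (by norm_num) ⟨2, by decide +kernel, by decide +kernel, by norm_num⟩
        ⟨1, by decide +kernel, by decide +kernel, by norm_num⟩),
    isSemistable_int_of_intModel_of_isCoprime intModel
      (by rw [Int.isCoprime_iff_gcd_eq_one]; decide +kernel)⟩

end C655a1

namespace C681c1

/-- **♠ for `681c1` at `p = 5`:** `|Δ_min| = 3^2·227` ⇒ `5 ∤ v_ℓ(Δ_min)` at every multiplicative `ℓ`;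
`gcd(c₄, Δ) = 1` ⇒ semistable. [cite: WZhang2014, Hypothesis ♠ (pp. 194–195)] [cite: CremonaAlgorithms1997, Table 1 (681c1)] -/
theorem spade_5 :
    haveI := isElliptic_c681c1;
    haveI := isGloballyMinimal_c681c1;
    (∀ (ℓ : ℕ) [Fact ℓ.Prime], ((⟨0, -1, 1, 0, 2⟩ : WeierstrassCurve ℤ).map (Int.castRingHom ℚ)).HasMultiplicativeReductionAtPrime ℓ →
      ¬ 5 ∣ padicValInt ℓ ((⟨0, -1, 1, 0, 2⟩ : WeierstrassCurve ℤ).map (Int.castRingHom ℚ)).minimalDiscriminantInt) ∧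
      ((⟨0, -1, 1, 0, 2⟩ : WeierstrassCurve ℤ).map (Int.castRingHom ℚ)).IsSemistable ℤ := by
  haveI := isElliptic_c681c1
  haveI := isGloballyMinimal_c681c1
  haveI := Fact.mk (by norm_num : Nat.Prime 5)
  exact ⟨not_dvd_padicValInt_of_intModel intModel 5
      (forall_prime_dvd_of_natAbs_eq_pow_mul_pow (a := 3) (i := 2) (b := 227) (j := 1) (by decide +kernel)
        (by norm_num) (by norm_num) ⟨2, by decide +kernel, by decide +kernel, by norm_num⟩
        ⟨1, by decide +kernel, by decide +kernel, by norm_num⟩),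
    isSemistable_int_of_intModel_of_isCoprime intModel
      (by rw [Int.isCoprime_iff_gcd_eq_one]; decide +kernel)⟩

end C681c1

namespace C707a1

/-- **♠ for `707a1` at `p = 5`:** `|Δ_min| = 7^2·101` ⇒ `5 ∤ v_ℓ(Δ_min)` at every multiplicative `ℓ`;
`gcd(c₄, Δ) = 1` ⇒ semistable. [cite: WZhang2014, Hypothesis ♠ (pp. 194–195)] [cite: CremonaAlgorithms1997, Table 1 (707a1)] -/
theorem spade_5 :
    haveI := isElliptic_c707a1;
    haveI := isGloballyMinimal_c707a1;
    (∀ (ℓ : ℕ) [Fact ℓ.Prime], ((⟨0, 1, 1, -12, 12⟩ : WeierstrassCurve ℤ).map (Int.castRingHom ℚ)).HasMultiplicativeReductionAtPrime ℓ →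
      ¬ 5 ∣ padicValInt ℓ ((⟨0, 1, 1, -12, 12⟩ : WeierstrassCurve ℤ).map (Int.castRingHom ℚ)).minimalDiscriminantInt) ∧
      ((⟨0, 1, 1, -12, 12⟩ : WeierstrassCurve ℤ).map (Int.castRingHom ℚ)).IsSemistable ℤ := by
  haveI := isElliptic_c707a1
  haveI := isGloballyMinimal_c707a1
  haveI := Fact.mk (by norm_num : Nat.Prime 5)
  exact ⟨not_dvd_padicValInt_of_intModel intModel 5
      (forall_prime_dvd_of_natAbs_eq_pow_mul_pow (a := 7) (i := 2) (b := 101) (j := 1) (by decide +kernel)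
        (by norm_num) (by norm_num) ⟨2, by decide +kernel, by decide +kernel, by norm_num⟩
        ⟨1, by decide +kernel, by decide +kernel, by norm_num⟩),
    isSemistable_int_of_intModel_of_isCoprime intModel
      (by rw [Int.isCoprime_iff_gcd_eq_one]; decide +kernel)⟩

end C707a1

namespace C709a1

/-- **♠ for `709a1` at `p = 5`:** `|Δ_min| = 709` (exponent `1`) ⇒ `5 ∤ v_ℓ(Δ_min)` at every multiplicative `ℓ`;
`gcd(c₄, Δ) = 1` ⇒ semistable. [cite: WZhang2014, Hypothesis ♠ (pp. 194–195)] [cite: CremonaAlgorithms1997, Table 1 (709a1)] -/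
theorem spade_5 :
    haveI := isElliptic_c709a1;
    haveI := isGloballyMinimal_c709a1;
    (∀ (ℓ : ℕ) [Fact ℓ.Prime], ((⟨0, -1, 1, -2, 0⟩ : WeierstrassCurve ℤ).map (Int.castRingHom ℚ)).HasMultiplicativeReductionAtPrime ℓ →
      ¬ 5 ∣ padicValInt ℓ ((⟨0, -1, 1, -2, 0⟩ : WeierstrassCurve ℤ).map (Int.castRingHom ℚ)).minimalDiscriminantInt) ∧
      ((⟨0, -1, 1, -2, 0⟩ : WeierstrassCurve ℤ).map (Int.castRingHom ℚ)).IsSemistable ℤ := by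
  haveI := isElliptic_c709a1
  haveI := isGloballyMinimal_c709a1
  haveI := Fact.mk (by norm_num : Nat.Prime 5)
  exact ⟨not_dvd_padicValInt_of_intModel intModel 5
      (forall_prime_dvd_of_natAbs_eq_pow (a := 709) (i := 1) (by decide +kernel) (by norm_num)
        ⟨1, by decide +kernel, by decide +kernel, by norm_num⟩),
    isSemistable_int_of_intModel_of_isCoprime intModel
      (by rw [Int.isCoprime_iff_gcd_eq_one]; decide +kernel)⟩

end C709a1

namespace C718b1

/-- **♠ for `718b1` at `p = 5`:** `|Δ_min| = 2^4·359` ⇒ `5 ∤ v_ℓ(Δ_min)` at every multiplicative `ℓ`;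
`gcd(c₄, Δ) = 1` ⇒ semistable. [cite: WZhang2014, Hypothesis ♠ (pp. 194–195)] [cite: CremonaAlgorithms1997, Table 1 (718b1)] -/
theorem spade_5 :
    haveI := isElliptic_c718b1;
    haveI := isGloballyMinimal_c718b1;
    (∀ (ℓ : ℕ) [Fact ℓ.Prime], ((⟨1, 0, 1, -5, 0⟩ : WeierstrassCurve ℤ).map (Int.castRingHom ℚ)).HasMultiplicativeReductionAtPrime ℓ →
      ¬ 5 ∣ padicValInt ℓ ((⟨1, 0, 1, -5, 0⟩ : WeierstrassCurve ℤ).map (Int.castRingHom ℚ)).minimalDiscriminantInt) ∧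
      ((⟨1, 0, 1, -5, 0⟩ : WeierstrassCurve ℤ).map (Int.castRingHom ℚ)).IsSemistable ℤ := by
  haveI := isElliptic_c718b1
  haveI := isGloballyMinimal_c718b1
  haveI := Fact.mk (by norm_num : Nat.Prime 5)
  exact ⟨not_dvd_padicValInt_of_intModel intModel 5
      (forall_prime_dvd_of_natAbs_eq_pow_mul_pow (a := 2) (i := 4) (b := 359) (j := 1) (by decide +kernel)
        (by norm_num) (by norm_num) ⟨4, by decide +kernel, by decide +kernel, by norm_num⟩
        ⟨1, by decide +kernel, by decide +kernel, by norm_num⟩),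
    isSemistable_int_of_intModel_of_isCoprime intModel
      (by rw [Int.isCoprime_iff_gcd_eq_one]; decide +kernel)⟩

end C718b1

namespace C794a1

/-- **♠ for `794a1` at `p = 5`:** `|Δ_min| = 2^2·397` ⇒ `5 ∤ v_ℓ(Δ_min)` at every multiplicative `ℓ`;
`gcd(c₄, Δ) = 1` ⇒ semistable. [cite: WZhang2014, Hypothesis ♠ (pp. 194–195)] [cite: CremonaAlgorithms1997, Table 1 (794a1)] -/
theorem spade_5 :
    haveI := isElliptic_c794a1;
    haveI := isGloballyMinimal_c794a1;
    (∀ (ℓ : ℕ) [Fact ℓ.Prime], ((⟨1, 0, 1, -3, 2⟩ : WeierstrassCurve ℤ).map (Int.castRingHom ℚ)).HasMultiplicativeReductionAtPrime ℓ →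
      ¬ 5 ∣ padicValInt ℓ ((⟨1, 0, 1, -3, 2⟩ : WeierstrassCurve ℤ).map (Int.castRingHom ℚ)).minimalDiscriminantInt) ∧
      ((⟨1, 0, 1, -3, 2⟩ : WeierstrassCurve ℤ).map (Int.castRingHom ℚ)).IsSemistable ℤ := by
  haveI := isElliptic_c794a1
  haveI := isGloballyMinimal_c794a1
  haveI := Fact.mk (by norm_num : Nat.Prime 5)
  exact ⟨not_dvd_padicValInt_of_intModel intModel 5
      (forall_prime_dvd_of_natAbs_eq_pow_mul_pow (a := 2) (i := 2) (b := 397) (j := 1) (by decide +kernel)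
        (by norm_num) (by norm_num) ⟨2, by decide +kernel, by decide +kernel, by norm_num⟩
        ⟨1, by decide +kernel, by decide +kernel, by norm_num⟩),
    isSemistable_int_of_intModel_of_isCoprime intModel
      (by rw [Int.isCoprime_iff_gcd_eq_one]; decide +kernel)⟩

end C794a1

namespace C817a1

/-- **♠ for `817a1` at `p = 5`:** `|Δ_min| = 19^2·43` ⇒ `5 ∤ v_ℓ(Δ_min)` at every multiplicative `ℓ`;
`gcd(c₄, Δ) = 1` ⇒ semistable. [cite: WZhang2014, Hypothesis ♠ (pp. 194–195)] [cite: CremonaAlgorithms1997, Table 1 (817a1)] -/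
theorem spade_5 :
    haveI := isElliptic_c817a1;
    haveI := isGloballyMinimal_c817a1;
    (∀ (ℓ : ℕ) [Fact ℓ.Prime], ((⟨0, 1, 1, 1, 6⟩ : WeierstrassCurve ℤ).map (Int.castRingHom ℚ)).HasMultiplicativeReductionAtPrime ℓ →
      ¬ 5 ∣ padicValInt ℓ ((⟨0, 1, 1, 1, 6⟩ : WeierstrassCurve ℤ).map (Int.castRingHom ℚ)).minimalDiscriminantInt) ∧
      ((⟨0, 1, 1, 1, 6⟩ : WeierstrassCurve ℤ).map (Int.castRingHom ℚ)).IsSemistable ℤ := by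
  haveI := isElliptic_c817a1
  haveI := isGloballyMinimal_c817a1
  haveI := Fact.mk (by norm_num : Nat.Prime 5)
  exact ⟨not_dvd_padicValInt_of_intModel intModel 5
      (forall_prime_dvd_of_natAbs_eq_pow_mul_pow (a := 19) (i := 2) (b := 43) (j := 1) (by decide +kernel)
        (by norm_num) (by norm_num) ⟨2, by decide +kernel, by decide +kernel, by norm_num⟩
        ⟨1, by decide +kernel, by decide +kernel, by norm_num⟩),
    isSemistable_int_of_intModel_of_isCoprime intModel
      (by rw [Int.isCoprime_iff_gcd_eq_one]; decide +kernel)⟩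

end C817a1

namespace C997b1

/-- **♠ for `997b1` at `p = 5`:** `|Δ_min| = 997` (exponent `1`) ⇒ `5 ∤ v_ℓ(Δ_min)` at every multiplicative `ℓ`;
`gcd(c₄, Δ) = 1` ⇒ semistable. [cite: WZhang2014, Hypothesis ♠ (pp. 194–195)] [cite: CremonaAlgorithms1997, Table 1 (997b1)] -/
theorem spade_5 :
    haveI := isElliptic_c997b1;
    haveI := isGloballyMinimal_c997b1;
    (∀ (ℓ : ℕ) [Fact ℓ.Prime], ((⟨0, -1, 1, -5, -3⟩ : WeierstrassCurve ℤ).map (Int.castRingHom ℚ)).HasMultiplicativeReductionAtPrime ℓ →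
      ¬ 5 ∣ padicValInt ℓ ((⟨0, -1, 1, -5, -3⟩ : WeierstrassCurve ℤ).map (Int.castRingHom ℚ)).minimalDiscriminantInt) ∧
      ((⟨0, -1, 1, -5, -3⟩ : WeierstrassCurve ℤ).map (Int.castRingHom ℚ)).IsSemistable ℤ := by
  haveI := isElliptic_c997b1
  haveI := isGloballyMinimal_c997b1
  haveI := Fact.mk (by norm_num : Nat.Prime 5)
  exact ⟨not_dvd_padicValInt_of_intModel intModel 5
      (forall_prime_dvd_of_natAbs_eq_pow (a := 997) (i := 1) (by decide +kernel) (by norm_num)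
        ⟨1, by decide +kernel, by decide +kernel, by norm_num⟩),
    isSemistable_int_of_intModel_of_isCoprime intModel
      (by rw [Int.isCoprime_iff_gcd_eq_one]; decide +kernel)⟩

end C997b1

namespace C997c1

/-- **♠ for `997c1` at `p = 5`:** `|Δ_min| = 997` (exponent `1`) ⇒ `5 ∤ v_ℓ(Δ_min)` at every multiplicative `ℓ`;
`gcd(c₄, Δ) = 1` ⇒ semistable. [cite: WZhang2014, Hypothesis ♠ (pp. 194–195)] [cite: CremonaAlgorithms1997, Table 1 (997c1)] -/
theorem spade_5 :
    haveI := isElliptic_c997c1;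
    haveI := isGloballyMinimal_c997c1;
    (∀ (ℓ : ℕ) [Fact ℓ.Prime], ((⟨0, -1, 1, -24, 54⟩ : WeierstrassCurve ℤ).map (Int.castRingHom ℚ)).HasMultiplicativeReductionAtPrime ℓ →
      ¬ 5 ∣ padicValInt ℓ ((⟨0, -1, 1, -24, 54⟩ : WeierstrassCurve ℤ).map (Int.castRingHom ℚ)).minimalDiscriminantInt) ∧
      ((⟨0, -1, 1, -24, 54⟩ : WeierstrassCurve ℤ).map (Int.castRingHom ℚ)).IsSemistable ℤ := by
  haveI := isElliptic_c997c1
  haveI := isGloballyMinimal_c997c1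
  haveI := Fact.mk (by norm_num : Nat.Prime 5)
  exact ⟨not_dvd_padicValInt_of_intModel intModel 5
      (forall_prime_dvd_of_natAbs_eq_pow (a := 997) (i := 1) (by decide +kernel) (by norm_num)
        ⟨1, by decide +kernel, by decide +kernel, by norm_num⟩),
    isSemistable_int_of_intModel_of_isCoprime intModel
      (by rw [Int.isCoprime_iff_gcd_eq_one]; decide +kernel)⟩

end C997c1

/-! ## The split-`p` rows: the row-specific prediction through BCGS 2026 (`d_K` odd, `p` split) -/

/-- **Row-specific λ-prediction from an atlas cell, split-`p` form (modulo BCGS 2026 Thm. 1 and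
Kolyvagin 1991 Thm. 4).** For the depth-table rows whose field has `d_K` ODD with `p` SPLIT — `664a1`
(`d_K = −39`), `707a1` (`−19`), `916c1` (`−111`), `944e1` (`−31`) at `p = 5` (`(d_K/5) = 1`), including
the three curves additive at `2` that W. Zhang's ♠(2) excludes — the tree's BCGS fact applies at the
row's OWN field: an atlas cell (`rank = 2 = s_p`, hence `t_p = 0`), `ρ̄_{E,p}` onto, `K` Heegner with
`d_K` odd, `∉ {−3,−4}`, `p ∤ d_K`, `p` split in `K`, and the twist datum `s_p(E^{(d_K)}) ≤ 1` give a
Kolyvagin PRIME `ℓ` for `(E, K, p)`, a level `1 ≤ M ≤ M(ℓ)` and a datum with `c_M(ℓ) ≠ 0` (g0's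
`exists_kolyvaginClass_prime_ne_zero_of_rank_two_of_shaCorank_eq_zero` fed by `AtlasCurve.padicRow`).
CONDITIONAL on `hA`, `hF`, `hPRS`, `hkato`, the symbol data and the twist datum; per-curve; BSD is not
proved by it. [cite: BurungaleEtAl2026, Thm. 1 (arXiv:2312.09301 §0.1)] [cite: Kolyvagin1991MathAnn, §2 Thm. 4]
[cite: SteinWuthrich2013, Thm. 1.1 and §3] -/
theorem exists_kolyvaginPrime_class_ne_zero_at_of_atlasCell_split
    (hA : BurungaleEtAl2026_exists_kolyvaginClass_ne_zero)
    (hF : Kolyvagin1991_selmerCorank_of_kolyvaginClass_ne_zero) (hPRS : Schneider1985_order_charGenerator)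
    {C : AtlasCurve} (hC : C.check = true) {c : AtlasCell} (hc : c ∈ C.cells) [hp : Fact c.p.Prime]
    (W : WeierstrassCurve ℚ) [W.IsElliptic] [W.IsGloballyMinimal] (hW : W = C.e.baseChange ℚ)
    {N : ℕ} [NeZero N] {f : CuspForm (Gamma0 N) 2} (hf : IsNewformOf W f)
    (hkato : ∀ (κ : ZpExtension ℚ c.p) (γ : Field.absoluteGaloisGroup ℚ),
      kato_divisibility W c.p (κ := κ) (γ := γ) (f := f))
    (hlow : 2 ≤ C.row.curve.mordellWeilRank) (D : ℚ) (hD : ‖(D : ℚ_[c.p])‖ = 1)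
    (hint : ∀ x : ℚ, ‖(ratPlusSymbol f x : ℚ_[c.p])‖ ≤ 1)
    (htab : ∀ u : ℕ, u < c.p ^ (c.n + 1) → ¬ c.p ∣ u →
      ratPlusSymbol f ((u : ℚ) / (c.p : ℚ) ^ (c.n + 1)) = (c.tabHi.getD u 0 : ℚ) / D ∧
      ratPlusSymbol f ((u : ℚ) / (c.p : ℚ) ^ c.n) = (c.tabLo.getD (u % c.p ^ c.n) 0 : ℚ) / D)
    (hsurj : W.HasSurjectiveModNGaloisRep c.p)
    (K : Type) [Field K] [NumberField K] (hK : IsImaginaryQuadratic K)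
    (h3 : NumberField.discr K ≠ -3) (h4 : NumberField.discr K ≠ -4)
    (hpd : ¬ ((c.p : ℤ) ∣ NumberField.discr K)) [NeZero (W.conductorNorm ℤ)]
    (hH : SatisfiesHeegnerHypothesis (W.conductorNorm ℤ) K) (hodd : Odd (NumberField.discr K))
    (hps : SatisfiesHeegnerHypothesis c.p K)
    (hc' : (W.quadraticTwist (NumberField.discr K : ℚ)).selmerCorank c.p ≤ 1) :
    ∃ (Dt : ModularParametrizationData W (W.conductorNorm ℤ)) (β : ℤ) (ι : K →+* ℂ) (ℓ : ℕ)
      (d : KolyvaginHeegnerData Dt β ι ℓ) (M : ℕ),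
      ℓ.Prime ∧ Zhang2014.IsKolyvaginPrime (W.conductorNorm ℤ) W K c.p ℓ ∧
      1 ≤ M ∧ (M : ℕ∞) ≤ Zhang2014.levelIndex W c.p ℓ ∧ d.kolyvaginClass hp.out M ≠ 0 := by
  subst hW
  have hk : c.check C.e = true := AtlasCurve.cell_check hC hc
  have h5 : 5 ≤ c.p := AtlasCell.five_le_of_check hk
  obtain ⟨hgood, hord⟩ := AtlasCell.isOrdinaryAt_of_check hk
  obtain ⟨hr2, -, -, -, hsel⟩ := AtlasCurve.padicRow hC hc hPRS hf hkato hlow D hD hint htab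
  have hr2' : (C.e.baseChange ℚ).mordellWeilRank = 2 := by rw [AtlasCurve.baseChange_e]; exact hr2
  have hid : (C.e.baseChange ℚ).selmerCorank c.p =
      (C.e.baseChange ℚ).mordellWeilRank + (C.e.baseChange ℚ).shaCorank c.p :=
    (C.e.baseChange ℚ).selmerCorank_eq_mordellWeilRank_add_holds c.p
  have ht : (C.e.baseChange ℚ).shaCorank c.p = 0 := by omega
  exact exists_kolyvaginClass_prime_ne_zero_of_rank_two_of_shaCorank_eq_zero hA hF _ hr2' c.p h5 hgood
    hord hsurj K hK h3 h4 hpd hH hodd hps hc' ht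

end Summit.BirchSwinnertonDyer.BirchSwinnertonDyer.Theorems.KolyvaginDepthDoor

end
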